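import Literature.AlgebraicGeometry.Smoothening.DefectDropPointwise
import Literature.AlgebraicGeometry.Smoothening.OpenChartJacobian
import Literature.AlgebraicGeometry.Smoothening.ForestStepData
import HarnessLib

/-!
# One step of the smoothening process in chart coordinates (BLR 3.4, proof of Thm. 2)

Topic: `Literature/AlgebraicGeometry/Smoothening` (Bosch–Lütkebohmert–Raynaud, *Néron Models*,
§3.4). Given a chart `X = Spec A`, `A = R[T₁, …, T_N]/I`, equations `g₁, …, g_r ∈ R[T]` of the
centre with Jacobian minor `Δ` on the columns `a`, and the open `D(h)`, we pass to the chart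
`R[T, U]/I'` of `X ∩ D(h)` (`OpenChart`), dilate the centre `𝔠 = (ϖ, g, hU - 1)` (`ChartCentre`)
and present the dilatation as `R[T, U, Z]/I''` (`DilatationChart`). For a point `a : A → S` with
values in a discrete valuation ring in which `ϖ` is a uniformizer, lying in `D(hΔ)` and reducing
into the centre, the lifted point `a''` of `R[T, U, Z]/I''` is built in `ForestStepData`; here we
assemble all the structure required by `DefectDropPointwise` and conclude (`forest_step`):

  `δ(a'') ≤ δ(a)`, and `δ(a'') + 1 ≤ δ(a)` if `δ(a) ≠ 0`,

under the chart-level hypotheses `h·I ⊆ (ϖ, g)`, density (`hinj`) and freeness of `Ω¹_X` along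
the centre of the chart. [folklore] assembly; no named facts (D-0026).

## References

* S. Bosch, W. Lütkebohmert, M. Raynaud, *Néron Models*, Springer 1990, §3.3 Prop. 5, §3.4
  Thm. 2. [BLRNeronModels1990] (Not held; numbers only.)
-/

noncomputable section

open scoped TensorProduct
open MvPolynomial KaehlerDifferential IsLocalRing
open Literature.AlgebraicGeometry.Dilatations Literature.AlgebraicGeometry.Resolution

namespace Literature.AlgebraicGeometry.Smoothening

universe u

/-! ### The step -/

section Main

variable {R : Type u} [CommRing R] [IsNoetherianRing R] (ϖ : R) {N r : ℕ}
  (I : Ideal (MvPolynomial (Fin N) R)) (g : Fin r → MvPolynomial (Fin N) R)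
  (cols : Fin r → Fin N) (h : MvPolynomial (Fin N) R)
  {S : Type u} [CommRing S] [IsDomain S] [IsDiscreteValuationRing S] [Algebra R S]
  (a : (MvPolynomial (Fin N) R ⧸ I) →ₐ[R] S)

local notation "B₁" => MvPolynomial (Fin (N + 1)) R
local notation "A₁" => MvPolynomial (Fin (N + 1)) R ⧸ chartIdeal I h
local notation "C₁" => MvPolynomial (Fin (N + 1)) R ⧸ centreIdealB ϖ (chartGens g h)
local notation "D₁" => dilatation ϖ (centreIdeal ϖ (chartIdeal I h) (chartGens g h))
local notation "A₂" => MvPolynomial (Fin (N + 1 + (r + 1))) R ⧸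
  dilIdeal ϖ (chartIdeal I h) (chartGens g h)

set_option maxHeartbeats 800000 in
/-- **One step of the smoothening process** (BLR 3.4, proof of Thm. 2, with 3.3/5): let
`X = Spec R[T]/I`, `g₁, …, g_r ∈ R[T]` with Jacobian minor `Δ` on the columns `cols`, `h ∈ R[T]`
with `h·I ⊆ (ϖ, g)`; assume the density hypothesis `hinj` for the dilatation of the chart
`R[T, U]/I'` of `X ∩ D(h)` in the centre `𝔠 = (ϖ, g, hU - 1)` and that `Ω¹_X` pulled back to the
centre `R[T, U]/𝔠` is free. Then every point `a : R[T]/I → S` (values in a discrete valuation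
ring in which `ϖ` is a uniformizer) with `a(h̄)`, `a(Δ̄)` units and `a(ḡⱼ) ∈ 𝔪_S` lifts to a point
`a''` of the dilatation chart `R[T, U, Z]/I''` with `δ(a'') ≤ δ(a)`, and `δ(a'') + 1 ≤ δ(a)` when
`δ(a) ≠ 0`. [cite: Artin1986NeronModels, Lemma (3.9) (p. 227)] -/
theorem forest_step (hIg : ∀ x ∈ I, h * x ∈ centreIdealB ϖ g)
    (hinj : Function.Injective (Ideal.quotientMap
      (Ideal.span {algebraMap R D₁ ϖ}) (algebraMap A₁ D₁)
      (Ideal.map_le_iff_le_comap.mp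
        (map_centreIdeal_dilatation_le ϖ (chartIdeal I h) (chartGens g h)))))
    (hfree : letI := algebraQuotCentre ϖ I g h (chartIdeal_le_centre ϖ I g h hIg)
      Module.Free C₁ (C₁ ⊗[A₁] Ω[A₁⁄R]))
    (hπ : Irreducible (algebraMap R S ϖ))
    (hh : IsUnit (a (Ideal.Quotient.mk I h)))
    (hΔ : IsUnit (a (Ideal.Quotient.mk I (jacobianDet g cols))))
    (hcen : ∀ j, a (Ideal.Quotient.mk I (g j)) ∈ maximalIdeal S) :
    ∃ a'' : A₂ →ₐ[R] S, (∀ x, a'' (toDilChart ϖ I g h x) = a x) ∧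
      neronDefectOfHom R S a'' ≤ neronDefectOfHom R S a ∧
      (neronDefectOfHom R S a ≠ 0 → neronDefectOfHom R S a'' + 1 ≤ neronDefectOfHom R S a) := by
  classical
  have hle := chartIdeal_le_centre ϖ I g h hIg
  -- the chart point and the lifted point
  have hcen₁ : ∀ j, chartPoint I h a hh (Ideal.Quotient.mk _ (chartGens g h j)) ∈ maximalIdeal S :=
    chartPoint_chartGens_mem I g h a hh hcen
  refine ⟨dilChartPoint ϖ I g h (chartPoint I h a hh) hπ hcen₁, fun x => ?_, ?_⟩
  · change dilChartPoint ϖ I g h (chartPoint I h a hh) hπ hcen₁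
      (algebraMap A₁ A₂ (algebraMap _ A₁ x)) = a x
    rw [dilChartPoint_algebraMap, chartPoint_algebraMap]
  -- the algebra structures defined by the points
  letI algAS : Algebra (MvPolynomial (Fin N) R ⧸ I) S := a.toRingHom.toAlgebra
  letI algA₁S : Algebra A₁ S := (chartPoint I h a hh).toRingHom.toAlgebra
  haveI : IsScalarTower R A₁ S :=
    IsScalarTower.of_algebraMap_eq (R := R) (S := A₁) (A := S) fun x =>
      ((chartPoint I h a hh).commutes x).symm
  haveI : IsScalarTower (MvPolynomial (Fin N) R ⧸ I) A₁ S :=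
    IsScalarTower.of_algebraMap_eq (R := MvPolynomial (Fin N) R ⧸ I) (S := A₁) (A := S)
      fun x => (chartPoint_algebraMap I h a hh x).symm
  letI algB₁S : Algebra B₁ S :=
    ((chartPoint I h a hh).toRingHom.comp (Ideal.Quotient.mk (chartIdeal I h))).toAlgebra
  haveI : IsScalarTower B₁ A₁ S :=
    IsScalarTower.of_algebraMap_eq (R := B₁) (S := A₁) (A := S) fun _ => rfl
  haveI : IsScalarTower R B₁ S :=
    IsScalarTower.of_algebraMap_eq (R := R) (S := B₁) (A := S) fun x =>
      ((chartPoint I h a hh).commutes x).symm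
  letI algD₁S : Algebra D₁ S := (dilatationPoint ϖ I g h (chartPoint I h a hh) hπ hcen₁).toAlgebra
  haveI : IsScalarTower A₁ D₁ S := IsScalarTower.of_algebraMap_eq (R := A₁) (S := D₁) (A := S)
    fun x => (dilatationPoint_algebraMap ϖ I g h (chartPoint I h a hh) hπ hcen₁ x).symm
  haveI : IsScalarTower R D₁ S := IsScalarTower.of_algebraMap_eq (R := R) (S := D₁) (A := S)
    fun x => by
      rw [IsScalarTower.algebraMap_apply R A₁ D₁, ← IsScalarTower.algebraMap_apply A₁ D₁ S,
        ← IsScalarTower.algebraMap_apply R A₁ S]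
  letI algA₂S : Algebra A₂ S :=
    (dilChartPoint ϖ I g h (chartPoint I h a hh) hπ hcen₁).toRingHom.toAlgebra
  -- the centre ring `C₁` and the prime `𝔓` below the closed point
  letI := algebraQuotCentre ϖ I g h hle
  haveI := isScalarTower_quotCentre ϖ I g h hle
  haveI := isScalarTower_quotCentre' ϖ I g h hle
  have hBS : ∀ p : MvPolynomial (Fin N) R,
      algebraMap B₁ S (rename Fin.castSucc p) = a (Ideal.Quotient.mk I p) := fun p =>
    chartPoint_mk_rename I h a hh p
  -- the residue map of the centre and the prime `𝔓` below the closed point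
  let ψ : C₁ →+* ResidueField S := centreResidue ϖ I g h a hh hπ.not_isUnit hcen
  have hψ : ∀ b, ψ (Ideal.Quotient.mk _ b) = residue S (algebraMap B₁ S b) := fun b => rfl
  let 𝔓 : Ideal C₁ := RingHom.ker ψ
  haveI h𝔓 : 𝔓.IsPrime := RingHom.ker_isPrime ψ
  -- the local ring `L` of the centre at `𝔓` and `L → κ(S)`
  have hunits : ∀ y : 𝔓.primeCompl, IsUnit (ψ y) := fun y =>
    isUnit_iff_ne_zero.mpr fun hy => y.2 ((RingHom.mem_ker).mpr hy)
  letI algLk : Algebra (Localization.AtPrime 𝔓) (ResidueField S) :=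
    (IsLocalization.lift (M := 𝔓.primeCompl) (S := Localization.AtPrime 𝔓) hunits).toAlgebra
  haveI : IsScalarTower A₁ (Localization.AtPrime 𝔓) (ResidueField S) :=
    IsScalarTower.of_algebraMap_eq (R := A₁) (S := Localization.AtPrime 𝔓) (A := ResidueField S)
      fun x => by
      obtain ⟨b, rfl⟩ := Ideal.Quotient.mk_surjective x
      rw [IsScalarTower.algebraMap_apply A₁ C₁ (Localization.AtPrime 𝔓)]
      change _ = IsLocalization.lift hunits (algebraMap C₁ _ (Ideal.Quotient.mk _ b))
      rw [IsLocalization.lift_eq, hψ, IsScalarTower.algebraMap_apply A₁ S (ResidueField S)]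
      rfl
  -- freeness along the centre at the point
  haveI : Module.Free (Localization.AtPrime 𝔓) (Localization.AtPrime 𝔓 ⊗[A₁] Ω[A₁⁄R]) :=
    Module.Free.of_equiv (TensorProduct.AlgebraTensorModule.cancelBaseChange A₁ C₁
      (Localization.AtPrime 𝔓) (Localization.AtPrime 𝔓) Ω[A₁⁄R])
  -- the polynomial ring `B₁`
  haveI : Module.Free B₁ Ω[B₁⁄R] := Module.Free.of_basis (KaehlerDifferential.mvPolynomialBasis R _)
  haveI : Module.Finite B₁ Ω[B₁⁄R] :=
    Module.Finite.of_basis (KaehlerDifferential.mvPolynomialBasis R _)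
  -- residues of the point
  have hres_ne : ∀ p : MvPolynomial (Fin N) R, IsUnit (a (Ideal.Quotient.mk I p)) →
      algebraMap B₁ (ResidueField S) (rename Fin.castSucc p) ≠ 0 := fun p hp h0 => by
    rw [IsScalarTower.algebraMap_apply B₁ S (ResidueField S), hBS, ResidueField.algebraMap_eq,
      residue_eq_zero_iff] at h0
    exact (mem_nonunits_iff.mp ((IsLocalRing.mem_maximalIdeal _).mp h0)) hp
  have hjac : algebraMap B₁ (ResidueField S) (jacobianDet (chartGens g h) (chartCols cols)) ≠ 0 := by
    rw [jacobianDet_chart, map_mul]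
    exact mul_ne_zero (hres_ne h hh) (hres_ne _ hΔ)
  have hres := linearIndependent_tmul_D_of_det_ne_zero (chartGens g h) (chartCols cols)
    (ResidueField S) hjac
  have hjacL : algebraMap B₁ (ResidueField (Localization.AtPrime 𝔓))
      (jacobianDet (chartGens g h) (chartCols cols)) ≠ 0 := by
    rw [IsScalarTower.algebraMap_apply B₁ (Localization.AtPrime 𝔓)
      (ResidueField (Localization.AtPrime 𝔓)), ResidueField.algebraMap_eq]
    refine (IsUnit.map (residue _) ?_).ne_zero
    rw [jacobianDet_chart, map_mul, IsScalarTower.algebraMap_apply B₁ C₁ (Localization.AtPrime 𝔓),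
      IsScalarTower.algebraMap_apply B₁ C₁ (Localization.AtPrime 𝔓)]
    refine IsUnit.mul ((isUnit_mk_centreIdealB_rename ϖ g h).map _) ?_
    refine (IsLocalization.AtPrime.isUnit_to_map_iff (Localization.AtPrime 𝔓) 𝔓 _).mpr ?_
    intro hmem
    refine hres_ne _ hΔ ?_
    rw [IsScalarTower.algebraMap_apply B₁ S (ResidueField S)]
    exact (RingHom.mem_ker).mp hmem
  have hresκ := linearIndependent_tmul_D_of_det_ne_zero (chartGens g h) (chartCols cols)
    (ResidueField (Localization.AtPrime 𝔓)) hjacL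
  have hunit : ∀ t : B₁, Ideal.Quotient.mk (centreIdealB ϖ (chartGens g h)) t ∉ 𝔓 →
      IsUnit (algebraMap B₁ S t) := by
    intro t ht
    have h0 : residue S (algebraMap B₁ S t) ≠ 0 := fun h0 => ht ((RingHom.mem_ker).mpr h0)
    exact not_not.mp fun hu => h0 ((residue_eq_zero_iff _).mpr
      ((IsLocalRing.mem_maximalIdeal _).mpr (mem_nonunits_iff.mpr hu)))
  -- BLR 3.3/5 at the point
  have h1 := neronDefect_dilatation_le ϖ (chartIdeal I h) (chartGens g h) 𝔓
    (Localization.AtPrime 𝔓) S hπ hres hresκ hinj hle hunit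
  have h2 := fun hδ => neronDefect_dilatation_add_one_le ϖ (chartIdeal I h) (chartGens g h) 𝔓
    (Localization.AtPrime 𝔓) S hπ hres hresκ hinj hle hunit hδ
  -- `δ` on the charts
  have hδ₁ : neronDefect R A₁ S = neronDefect R (MvPolynomial (Fin N) R ⧸ I) S :=
    neronDefect_chart_eq I h S
  have hδ₂ : neronDefect R A₂ S = neronDefect R D₁ S :=
    neronDefect_dil_eq ϖ (chartIdeal I h) (chartGens g h) S fun x => by
      change dilatationPoint ϖ I g h (chartPoint I h a hh) hπ hcen₁ (dilEquiv ϖ (chartIdeal I h)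
        (chartGens g h) ((dilEquiv ϖ (chartIdeal I h) (chartGens g h)).symm x)) = _
      rw [AlgEquiv.apply_symm_apply]
      rfl
  change neronDefect R A₂ S ≤ neronDefect R (MvPolynomial (Fin N) R ⧸ I) S ∧
    (neronDefect R (MvPolynomial (Fin N) R ⧸ I) S ≠ 0 →
      neronDefect R A₂ S + 1 ≤ neronDefect R (MvPolynomial (Fin N) R ⧸ I) S)
  rw [hδ₂, ← hδ₁]
  exact ⟨h1, h2⟩

end Main

end Literature.AlgebraicGeometry.Smoothening

end
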